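import Summits.QuantumFields.QCD.Theses.HeatSlicedQuarks
import Literature.LinearAlgebra.Matrix.FiniteRangeDecompositionMatrixSum
import Literature.LinearAlgebra.Matrix.FiniteRangeDecompositionMatrixBounds
import Literature.MathematicalPhysics.QuantumLattice.OverlapLocality
import Literature.LinearAlgebra.Matrix.SkewNormalForm

/-!
# Crux `InterleavedFlowProper` (stmt-QuantumFields-18031), line `finite-range-heat-slices` —
# stub `stub_finiteRangeHeatSlices` (FORMAT 1), part 1: the Bauerschmidt pieces of the massive Wilson square
# sum to the Green function and have ℓ²-norm `≤ C 4ⁿ (1 + μ² 4ⁿ)⁻³`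

Registered helper `stub_frPiecesSumNorm` (spectral bound fixed at `Θ = 64`): clauses (sum) and (mass decay)
of `FRHeatSlices` of the skeleton `Cruxes/InterleavedFlowProper/Lines/finite_range_heat_slices.lean`.
-/

noncomputable section

namespace Summit.QuantumFields.QCD.Cruxes.InterleavedFlowProper.FiniteRangeHeatSlices

open scoped BigOperators Matrix ComplexOrder
open Filter Topology
open Literature.MathematicalPhysics.QuantumFieldTheory Literature.MathematicalPhysics.QuantumLattice
open Literature.Probability.LatticeModels (TorusSite)
open Literature.LinearAlgebra.Matrix (MatrixFRD.piece)

section Helpers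

open scoped MatrixOrder
open Literature.LinearAlgebra.Matrix Literature.LinearAlgebra.Matrix.MatrixFRD MeasureTheory Set

variable {ι : Type*} [Fintype ι] [DecidableEq ι]

/-- The zeroth scale function vanishes: `g_0 = 0` (its scale interval `(s_{0-1}, s_0] = (0,0]` is
empty). [folklore] -/
theorem gFun_zero_eq (Θ L : ℝ) : gFun Θ L 0 = fun _ => 0 := by
  funext μ; simp [gFun]

/-- The zeroth piece vanishes: `C_0 = g_0(Q) = 0`. [folklore] -/
theorem piece_zero_eq (Q : Matrix ι ι ℂ) (Θ L : ℝ) : piece Q Θ L 0 = 0 := by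
  unfold piece; rw [gFun_zero_eq]; exact cfc_const_zero ℝ Q

/-- Reindexing: `Σ_{n < N+1} C_n = Σ_{j ∈ [1,N]} C_j` since `C_0 = 0`. [folklore] -/
theorem sum_range_succ_piece_eq (Q : Matrix ι ι ℂ) (Θ L : ℝ) (N : ℕ) :
    ∑ n ∈ Finset.range (N + 1), piece Q Θ L n = ∑ j ∈ Finset.Icc 1 N, piece Q Θ L j := by
  induction N with
  | zero => simp [piece_zero_eq]
  | succ N ih => rw [Finset.sum_range_succ, ih, Finset.sum_Icc_succ_top (by omega : 1 ≤ N + 1)]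

/-- The scale endpoints `s_N = L^N/2` exhaust `(0, ∞)` for `L > 1`: `⋂_N (s_N, ∞) = ∅`.
[folklore] -/
theorem iInter_Ioi_scaleEnd_eq_empty {L : ℝ} (hL : 1 < L) : (⋂ N : ℕ, Ioi (scaleEnd L N)) = ∅ := by
  ext t
  simp only [mem_iInter, mem_Ioi, mem_empty_iff_false, iff_false, not_forall, not_lt]
  have htend : Tendsto (fun N : ℕ => L ^ N / 2) atTop atTop :=
    (tendsto_pow_atTop_atTop_of_one_lt hL).atTop_div_const (by norm_num)
  obtain ⟨N, hN⟩ := (htend.eventually_ge_atTop t).exists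
  refine ⟨N + 1, ?_⟩
  rw [scaleEnd_of_ne_zero L (Nat.succ_ne_zero N)]
  exact hN.trans
    (div_le_div_of_nonneg_right (pow_le_pow_right₀ hL.le (Nat.le_succ N)) (by norm_num))

/-- **The top scale function tends to zero**: for `0 < ν < 4Θ` and `L > 1`,
`g_N^♭(ν) = ∫_{(s_N,∞)} ŵ_Θ(t,ν) dt/t → 0` (tails of the convergent `∫₀^∞ ŵ/t = ν⁻¹`). [folklore] -/
theorem tendsto_gTop_atTop {Θ : ℝ} (hΘ : 0 < Θ) {L : ℝ} (hL : 1 < L) {ν : ℝ} (h0 : 0 < ν)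
    (h4 : ν < 4 * Θ) : Tendsto (fun N : ℕ => gTop Θ L N ν) atTop (𝓝 0) := by
  have heq : ∀ N : ℕ, gTop Θ L N ν = ∫ t in Ioi (scaleEnd L N), wFun Θ t ν / t := fun N => by
    simp [gTop, h0.ne']
  simp_rw [heq]
  have hanti : Antitone fun N : ℕ => Ioi (scaleEnd L N) := fun a b hab =>
    Ioi_subset_Ioi ((monotone_nat_of_le_succ (scaleEnd_le_succ hL.le)) hab)
  have h := tendsto_setIntegral_of_antitone (μ := volume) (f := fun t => wFun Θ t ν / t)
    (fun N => measurableSet_Ioi) hanti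
    ⟨0, by simpa using integrableOn_wFun_div_Ioi hΘ h0 h4 le_rfl⟩
  rwa [iInter_Ioi_scaleEnd_eq_empty hL, setIntegral_empty] at h

/-- **The top piece tends to zero** (entrywise, i.e. in the matrix topology) when the spectrum of
`Q` lies in `(0, 4Θ)` and `L > 1`. [folklore] -/
theorem tendsto_top_atTop {Q : Matrix ι ι ℂ} (hQ : Q.IsHermitian) {Θ : ℝ} (hΘ : 0 < Θ) {L : ℝ}
    (hL : 1 < L) (hsp : ∀ ν ∈ spectrum ℝ Q, 0 < ν ∧ ν < 4 * Θ) :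
    Tendsto (fun N : ℕ => top Q Θ L N) atTop (𝓝 0) := by
  have hspecQ := hQ.spectral_theorem
  set U : Matrix ι ι ℂ := (hQ.eigenvectorUnitary : Matrix ι ι ℂ) with hU
  have hUmem : U ∈ Matrix.unitaryGroup ι ℂ := hQ.eigenvectorUnitary.2
  refine tendsto_pi_nhds.mpr fun x => tendsto_pi_nhds.mpr fun y => ?_
  have h : Tendsto (fun N : ℕ => ∑ k, U x k * (RCLike.ofReal (gTop Θ L N (hQ.eigenvalues k)) : ℂ) *
      star (U y k)) atTop (𝓝 (∑ k, U x k * (RCLike.ofReal 0 : ℂ) * star (U y k))) := by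
    refine tendsto_finsetSum _ fun k _ => ?_
    have hk := hsp _ (hQ.eigenvalues_mem_spectrum_real k)
    have hg : Tendsto (fun N : ℕ => (RCLike.ofReal (gTop Θ L N (hQ.eigenvalues k)) : ℂ)) atTop
        (𝓝 (RCLike.ofReal 0 : ℂ)) :=
      (RCLike.continuous_ofReal.tendsto _).comp (tendsto_gTop_atTop hΘ hL hk.1 hk.2)
    exact (tendsto_const_nhds.mul hg).mul tendsto_const_nhds
  simp only [RCLike.ofReal_zero, mul_zero, zero_mul, Finset.sum_const_zero] at h
  have hfun : ∀ N : ℕ, top Q Θ L N x y =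
      ∑ k, U x k * (RCLike.ofReal (gTop Θ L N (hQ.eigenvalues k)) : ℂ) * star (U y k) := fun N => by
    unfold top
    rw [cfc_apply_eq_sum hUmem hspecQ]
  simp_rw [hfun, Matrix.zero_apply]
  exact h

/-- On a matrix with spectrum in `(0, ∞)` the kernel projection `Π₀ = 𝟙_{0}(Q)` vanishes.
[folklore] -/
theorem cfc_indicator_eq_zero {Q : Matrix ι ι ℂ} (hsp : ∀ ν ∈ spectrum ℝ Q, 0 < ν) :
    cfc (fun μ : ℝ => if μ = 0 then (1 : ℝ) else 0) Q = 0 := by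
  rw [← cfc_const_zero ℝ Q]
  exact cfc_congr fun ν hν => by simp [(hsp ν hν).ne']

/-- On a matrix with spectrum in `(0, ∞)`, `cfc (·⁻¹) Q = Q⁻¹`. [folklore] -/
theorem cfc_inv_eq_inv {Q : Matrix ι ι ℂ} (hQ : Q.IsHermitian) (hsp : ∀ ν ∈ spectrum ℝ Q, 0 < ν) :
    cfc (fun μ : ℝ => μ⁻¹) Q = Q⁻¹ := by
  have h := mul_cfc_inv (𝕜 := ℂ) hQ
  rw [cfc_indicator_eq_zero hsp, sub_zero] at h
  exact (Matrix.inv_eq_right_inv h).symm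

/-- **Partial sums of the pieces converge to the inverse**: for `Q ⪰ 0` with spectrum in
`(0, 2Θ]` and `L > 1`, `Σ_{n ≤ N} C_n = Q⁻¹ − C_N^♭ → Q⁻¹`.
[cite: Bauerschmidt2013, Thm. 1.2 (the pieces sum to the Green function)] -/
theorem tendsto_sum_range_piece {Q : Matrix ι ι ℂ} (hQ : Q.PosSemidef) {Θ : ℝ} (hΘ : 0 < Θ)
    {L : ℝ} (hL : 1 < L) (hsp : ∀ ν ∈ spectrum ℝ Q, 0 < ν ∧ ν ≤ 2 * Θ) :
    Tendsto (fun N : ℕ => ∑ n ∈ Finset.range (N + 1), piece Q Θ L n) atTop (𝓝 Q⁻¹) := by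
  have hident : ∀ N : ℕ, ∑ n ∈ Finset.range (N + 1), piece Q Θ L n = Q⁻¹ - top Q Θ L N := by
    intro N
    have h := sum_piece_add_top hQ hΘ (fun ν hν => (hsp ν hν).2) hL.le N
    rw [cfc_indicator_eq_zero fun ν hν => (hsp ν hν).1, smul_zero, add_zero,
      cfc_inv_eq_inv hQ.1 fun ν hν => (hsp ν hν).1] at h
    rw [sum_range_succ_piece_eq, ← h, add_sub_cancel_right]
  simp_rw [hident]
  simpa using (tendsto_const_nhds (x := Q⁻¹)).sub
    (tendsto_top_atTop hQ.1 hΘ hL fun ν hν => ⟨(hsp ν hν).1, by linarith [(hsp ν hν).2]⟩)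

/-- From summability and the convergence of the partial sums: `HasSum C Q⁻¹`. [folklore] -/
theorem hasSum_piece_of_summable {Q : Matrix ι ι ℂ} (hQ : Q.PosSemidef) {Θ : ℝ} (hΘ : 0 < Θ)
    {L : ℝ} (hL : 1 < L) (hsp : ∀ ν ∈ spectrum ℝ Q, 0 < ν ∧ ν ≤ 2 * Θ)
    (hs : Summable fun n : ℕ => piece Q Θ L n) : HasSum (fun n : ℕ => piece Q Θ L n) Q⁻¹ := by
  have heq : ∑' n, piece Q Θ L n = Q⁻¹ := tendsto_nhds_unique
    (hs.hasSum.tendsto_sum_nat.comp (tendsto_add_atTop_nat 1))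
    (tendsto_sum_range_piece hQ hΘ hL hsp)
  exact heq ▸ hs.hasSum

open scoped Matrix.Norms.L2Operator in
/-- **`‖f(Q) v‖₂ ≤ (sup_{σ(Q)} |f|) ‖v‖₂`**: the spectral bound `‖cfc f Q‖ ≤ c` of the isometric
functional calculus (`ℓ²` operator norm) in quadratic-form language. [folklore] -/
theorem sum_norm_sq_cfc_mulVec_le {L N : ℕ} [NeZero L]
    (Q : Matrix (TorusSite 4 L × Fin N × Fin 4) (TorusSite 4 L × Fin N × Fin 4) ℂ) {f : ℝ → ℝ}
    {c : ℝ} (hc : 0 ≤ c) (hf : ∀ x ∈ spectrum ℝ Q, |f x| ≤ c)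
    (v : TorusSite 4 L × Fin N × Fin 4 → ℂ) :
    ∑ i, ‖(cfc f Q *ᵥ v) i‖ ^ 2 ≤ c ^ 2 * ∑ i, ‖v i‖ ^ 2 := by
  have hnorm : ‖cfc f Q‖ ≤ c :=
    norm_cfc_le hc fun x hx => by rw [Real.norm_eq_abs]; exact hf x hx
  exact (sum_norm_sq_mulVec_le _ v).trans (mul_le_mul_of_nonneg_right
    (pow_le_pow_left₀ (norm_nonneg _) hnorm 2) (Finset.sum_nonneg fun i _ => by positivity))

/-- Entries are bounded by the `ℓ² → ℓ²` bound: if `‖M v‖₂ ≤ c‖v‖₂` for all `v`, then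
`‖M x y‖ ≤ c` (test with `v = e_y`). [folklore] -/
theorem norm_apply_le_of_sum_norm_sq_mulVec_le {M : Matrix ι ι ℂ} {c : ℝ} (hc : 0 ≤ c)
    (h : ∀ v : ι → ℂ, ∑ i, ‖(M *ᵥ v) i‖ ^ 2 ≤ c ^ 2 * ∑ i, ‖v i‖ ^ 2) (x y : ι) :
    ‖M x y‖ ≤ c := by
  have h1 := h (Pi.single y 1)
  have hsingle : ∑ i, ‖(Pi.single y (1 : ℂ) : ι → ℂ) i‖ ^ 2 = 1 := by
    rw [Finset.sum_eq_single y (fun i _ hi => by simp [hi]) (fun h => absurd (Finset.mem_univ y) h)]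
    simp
  rw [Matrix.mulVec_single_one, hsingle, mul_one] at h1
  have h2 : ‖M x y‖ ^ 2 ≤ ∑ i, ‖M.col y i‖ ^ 2 :=
    Finset.single_le_sum (f := fun i => ‖M.col y i‖ ^ 2) (fun i _ => by positivity)
      (Finset.mem_univ x)
  exact (pow_le_pow_iff_left₀ (norm_nonneg _) hc two_ne_zero).mp (h2.trans h1)

/-- **Summability from `ℓ²` bounds**: if `‖C_n v‖₂ ≤ s_n ‖v‖₂` with `Σ s_n < ∞`, then the matrix
series `Σ_n C_n` is summable (entrywise absolute convergence). [folklore] -/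
theorem summable_of_sum_norm_sq_mulVec_le {C : ℕ → Matrix ι ι ℂ} {s : ℕ → ℝ} (hs0 : ∀ n, 0 ≤ s n)
    (hs : Summable s)
    (h : ∀ (n : ℕ) (v : ι → ℂ), ∑ i, ‖(C n *ᵥ v) i‖ ^ 2 ≤ s n ^ 2 * ∑ i, ‖v i‖ ^ 2) :
    Summable C :=
  Pi.summable.mpr fun x => Pi.summable.mpr fun y =>
    Summable.of_norm_bounded hs fun n => norm_apply_le_of_sum_norm_sq_mulVec_le (hs0 n) (h n) x y

/-- Pure real arithmetic behind the mass decay: with `y = 4^k ≥ 1`, `0 ≤ a = μ² ≤ 1`, `a ≤ ν`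
and an indicator `e ≤ 1` present only when `y = 1`,
`K/64 · (e + y (1 + (y/4)(ν/64))⁻³) ≤ K 2²³ · (4y) · (1 + a·4y)⁻³`. [folklore] -/
theorem majorant_arith {K y a ν e : ℝ} (hK : 0 ≤ K) (hy : 1 ≤ y) (ha0 : 0 ≤ a) (ha1 : a ≤ 1)
    (hν : a ≤ ν) (he1 : e ≤ 1) (he : e = 0 ∨ y = 1) :
    K / 64 * (e + y * ((1 + y / 4 * (ν / 64)) ^ 3)⁻¹) ≤
      K * 2 ^ 23 * (y * 4) * ((1 + a * (y * 4))⁻¹) ^ 3 := by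
  have hν0 : 0 ≤ ν := ha0.trans hν
  have hy0 : 0 ≤ y := zero_le_one.trans hy
  set b : ℝ := 1 + a * (y * 4) with hb
  have hb0 : 0 < b := by positivity
  have hinv : (1 + y / 4 * (ν / 64))⁻¹ ≤ 1024 * b⁻¹ := by
    rw [show (1024 : ℝ) * b⁻¹ = (b / 1024)⁻¹ by rw [inv_div]; ring]
    refine inv_anti₀ (by positivity) ?_
    rw [hb, div_le_iff₀ (by norm_num : (0:ℝ) < 1024)]
    nlinarith [mul_le_mul_of_nonneg_left hν hy0]
  have hind : e ≤ 2 ^ 30 * y * (b⁻¹) ^ 3 := by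
    rcases he with he' | hy1
    · rw [he']; positivity
    · have h5 : (1 / 5 : ℝ) ≤ b⁻¹ := by
        rw [one_div]; exact inv_anti₀ hb0 (by rw [hb, hy1]; nlinarith)
      calc e ≤ 2 ^ 30 * 1 * (1 / 5 : ℝ) ^ 3 := he1.trans (by norm_num)
        _ ≤ 2 ^ 30 * y * (b⁻¹) ^ 3 := by gcongr
  rw [← inv_pow]
  calc K / 64 * (e + y * (1 + y / 4 * (ν / 64))⁻¹ ^ 3)
      ≤ K / 64 * (2 ^ 30 * y * (b⁻¹) ^ 3 + y * (1024 * b⁻¹) ^ 3) :=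
        mul_le_mul_of_nonneg_left (add_le_add hind (mul_le_mul_of_nonneg_left
          (pow_le_pow_left₀ (by positivity) hinv 3) hy0)) (by positivity)
    _ = K * 2 ^ 23 * (y * 4) * (b⁻¹) ^ 3 := by ring

/-- **The mass decay of the scale functions at `Θ = 64`, `L = 2`**: with the constant `K` of the
canonical majorant (`MatrixFRD.exists_gFun_le_majorant`), for `n ≥ 1`, `0 < μ ≤ 1` and
`μ² ≤ ν ≤ 256`: `g_n(ν) ≤ K 2²³ · 4ⁿ · (1 + μ² 4ⁿ)⁻³`.
[cite: BauerschmidtBrydgesSlade2019RG, Ch. 3, Proposition "Covariance decomposition", (3.11)] -/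
theorem gFun_le_decay {K : ℝ} (hK : 0 < K)
    (hmaj : ∀ Θ : ℝ, 0 < Θ → ∀ L : ℝ, 2 ≤ L → ∀ j : ℕ, 1 ≤ j → ∀ μ : ℝ, 0 ≤ μ →
      gFun Θ L j μ ≤ K / Θ * ((if j = 1 then (1:ℝ) else 0) +
        (L ^ j / 2) ^ 2 * ((1 + (L ^ (j - 1) / 2) ^ 2 * (min μ (4 * Θ) / Θ)) ^ 3)⁻¹))
    {μ : ℝ} (hμ0 : 0 < μ) (hμ1 : μ ≤ 1) {n : ℕ} (hn : 1 ≤ n) {ν : ℝ} (hν : μ ^ 2 ≤ ν)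
    (hν' : ν ≤ 256) :
    gFun 64 2 n ν ≤ K * 2 ^ 23 * 4 ^ n * ((1 + μ ^ 2 * 4 ^ n)⁻¹) ^ 3 := by
  obtain ⟨k, rfl⟩ : ∃ k, n = k + 1 := ⟨n - 1, by omega⟩
  have hμ2 : 0 ≤ μ ^ 2 := sq_nonneg μ
  have h := hmaj 64 (by norm_num) 2 le_rfl (k + 1) hn ν (hμ2.trans hν)
  have h2k : (2 : ℝ) ^ (k + 1) / 2 = 2 ^ k := by rw [pow_succ]; ring
  have h4k : (4 : ℝ) ^ k = (2 ^ k) ^ 2 := by rw [← pow_mul, mul_comm, pow_mul]; norm_num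
  have hrew : ((2 : ℝ) ^ k / 2) ^ 2 * (ν / 64) = (2 ^ k) ^ 2 / 4 * (ν / 64) := by ring
  rw [min_eq_left (by linarith : ν ≤ 4 * 64), h2k, Nat.add_sub_cancel, hrew] at h
  have he1 : (if k + 1 = 1 then (1:ℝ) else 0) ≤ 1 := by split_ifs <;> norm_num
  have he : (if k + 1 = 1 then (1:ℝ) else 0) = 0 ∨ ((2 : ℝ) ^ k) ^ 2 = 1 := by
    rcases Nat.eq_zero_or_pos k with rfl | hk
    · right; norm_num
    · left; rw [if_neg (by omega)]
  refine h.trans ((majorant_arith hK.le (one_le_pow₀ (one_le_pow₀ (by norm_num))) hμ2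
    (by nlinarith) hν he1 he).trans_eq ?_)
  rw [pow_succ (4 : ℝ) k, h4k]

omit [DecidableEq ι] in
/-- `v* (Dᴴ D) v = (Dv)* (Dv)`. [folklore] -/
theorem star_dotProduct_conjTranspose_mul_self_mulVec (D : Matrix ι ι ℂ) (v : ι → ℂ) :
    star v ⬝ᵥ ((Dᴴ * D) *ᵥ v) = star (D *ᵥ v) ⬝ᵥ (D *ᵥ v) := by
  rw [← Matrix.mulVec_mulVec, Matrix.dotProduct_mulVec, Matrix.vecMul_conjTranspose, star_star]

/-- `v* (r·1) v = r · v* v` for a real scalar `r`. [folklore] -/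
theorem star_dotProduct_smul_one_mulVec (r : ℝ) (v : ι → ℂ) :
    star v ⬝ᵥ ((r • (1 : Matrix ι ι ℂ)) *ᵥ v) = (r : ℂ) * (star v ⬝ᵥ v) := by
  rw [Matrix.smul_mulVec, Matrix.one_mulVec, dotProduct_smul, Complex.real_smul]

/-- **The spectral window of a massive square.**  If `‖D v‖₂² ≤ 81 ‖v‖₂²` for all `v` and
`0 < μ ≤ 1`, then `Q = Dᴴ D + μ²·1` is positive semi-definite with `spectrum ⊂ [μ², 128]`
(quadratic form `v*Qv = ‖Dv‖² + μ²‖v‖² ∈ [μ²‖v‖², 82‖v‖²]`, Loewner order ↔ spectrum). [folklore] -/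
theorem massiveSquare_posSemidef_spectrum {D : Matrix ι ι ℂ}
    (hDv : ∀ v : ι → ℂ, ∑ i, ‖(D *ᵥ v) i‖ ^ 2 ≤ 81 * ∑ i, ‖v i‖ ^ 2) {μ : ℝ}
    (hμ : μ ∈ Set.Ioc (0 : ℝ) 1) {Q : Matrix ι ι ℂ}
    (hQ : Q = Dᴴ * D + ((μ : ℂ) ^ 2) • (1 : Matrix ι ι ℂ)) :
    Q.PosSemidef ∧ ∀ ν ∈ spectrum ℝ Q, μ ^ 2 ≤ ν ∧ ν ≤ 128 := by
  have hsmul : ((μ : ℂ) ^ 2) • (1 : Matrix ι ι ℂ) = (μ ^ 2 : ℝ) • (1 : Matrix ι ι ℂ) := by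
    rw [← algebraMap_smul ℂ (μ ^ 2 : ℝ), Complex.coe_algebraMap, Complex.ofReal_pow]
  have hQ' : Q = Dᴴ * D + (μ ^ 2 : ℝ) • (1 : Matrix ι ι ℂ) := by rw [hQ, hsmul]
  have hQherm : Q.IsHermitian := by
    rw [hQ']
    exact (Matrix.isHermitian_conjTranspose_mul_self D).add
      (Matrix.isHermitian_one.smul (IsSelfAdjoint.all _))
  have hquad : ∀ v : ι → ℂ, star v ⬝ᵥ (Q *ᵥ v) =
      ((∑ i, ‖(D *ᵥ v) i‖ ^ 2 + μ ^ 2 * ∑ i, ‖v i‖ ^ 2 : ℝ) : ℂ) := fun v => by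
    rw [hQ', Matrix.add_mulVec, dotProduct_add, star_dotProduct_conjTranspose_mul_self_mulVec,
      Matrix.star_dotProduct_self_eq_ofReal, star_dotProduct_smul_one_mulVec,
      Matrix.star_dotProduct_self_eq_ofReal, ← Complex.ofReal_mul, ← Complex.ofReal_add]
  refine ⟨?_, fun ν hν => ⟨?_, ?_⟩⟩
  · refine Matrix.PosSemidef.of_dotProduct_mulVec_nonneg hQherm fun v => ?_
    rw [hquad]
    exact Complex.zero_le_real.mpr (by positivity)
  · have hQsa : IsSelfAdjoint Q := hQherm
    have hle : algebraMap ℝ (Matrix ι ι ℂ) (μ ^ 2) ≤ Q := by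
      rw [Matrix.le_iff, Algebra.algebraMap_eq_smul_one, hQ', add_sub_cancel_right]
      exact Matrix.posSemidef_conjTranspose_mul_self D
    exact (algebraMap_le_iff_le_spectrum hQsa).mp hle ν hν
  · refine MatrixFRD.spectrum_le_of_posSemidef_sub hQherm ?_ ν hν
    refine Matrix.PosSemidef.of_dotProduct_mulVec_nonneg ?_ fun v => ?_
    · exact (Matrix.isHermitian_one.smul (IsSelfAdjoint.all _)).sub hQherm
    · rw [Matrix.sub_mulVec, dotProduct_sub, star_dotProduct_smul_one_mulVec,
        Matrix.star_dotProduct_self_eq_ofReal, hquad, ← Complex.ofReal_mul, ← Complex.ofReal_sub]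
      have h1 := hDv v
      have hμ1 : μ ^ 2 ≤ 1 := by nlinarith [hμ.1, hμ.2]
      have h0 : 0 ≤ ∑ i, ‖v i‖ ^ 2 := Finset.sum_nonneg fun i _ => by positivity
      exact Complex.zero_le_real.mpr (by nlinarith)

open scoped Matrix.Norms.L2Operator in
/-- **`‖D_W v‖₂² ≤ 81 ‖v‖₂²`** for the `r = 1` Wilson–Dirac matrix of an `SU(3)` field with
`m ∈ [−1/2, 1]`: `‖D_W‖ ≤ |m + 4| + 4 ≤ 9` (HJL (2.14)).
[cite: HernandezJansenLuscher1999, (2.14)] -/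
theorem sum_norm_sq_wilsonDirac_mulVec_le_81 {L : ℕ} [NeZero L]
    (U : GaugeConfig 4 L (Matrix.specialUnitaryGroup (Fin 3) ℂ)) {m : ℝ}
    (hm : m ∈ Set.Icc (-(1 / 2 : ℝ)) 1) (v : TorusSite 4 L × Fin 3 × Fin 4 → ℂ) :
    ∑ i, ‖(wilsonDirac (fundamentalRep (Fin 3)) U m 1 *ᵥ v) i‖ ^ 2 ≤ 81 * ∑ i, ‖v i‖ ^ 2 := by
  have h9 : ‖wilsonDirac (fundamentalRep (Fin 3)) U m 1‖ ≤ 9 := by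
    refine (l2_opNorm_wilsonDirac_le (fundamentalRep (Fin 3))
      (fun g => fundamentalRep_mem_unitaryGroup g) U m).trans ?_
    rw [abs_of_pos (by linarith [hm.1])]
    linarith [hm.2]
  refine (sum_norm_sq_mulVec_le _ v).trans
    (mul_le_mul_of_nonneg_right ?_ (Finset.sum_nonneg fun i _ => by positivity))
  nlinarith [norm_nonneg (wilsonDirac (fundamentalRep (Fin 3)) U m 1)]

/-- Summability of the decay profile `n ↦ K 2²³ 4ⁿ (1 + μ²4ⁿ)⁻³` (`μ > 0`): it is dominated by
the geometric series `K 2²³ μ⁻⁶ 4⁻ⁿ`. [folklore] -/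
theorem summable_decay {K μ : ℝ} (hK : 0 ≤ K) (hμ : 0 < μ) :
    Summable fun n : ℕ => K * 2 ^ 23 * 4 ^ n * ((1 + μ ^ 2 * 4 ^ n)⁻¹) ^ 3 := by
  have hgeom : Summable fun n : ℕ => K * 2 ^ 23 * (μ ^ 2)⁻¹ ^ 3 * ((4 : ℝ)⁻¹) ^ n :=
    (summable_geometric_of_lt_one (by norm_num) (by norm_num)).mul_left _
  refine Summable.of_nonneg_of_le (fun n => by positivity) (fun n => ?_) hgeom
  rw [inv_pow (4 : ℝ) n]
  have ht1 : (1 : ℝ) ≤ 4 ^ n := one_le_pow₀ (by norm_num)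
  generalize (4 : ℝ) ^ n = t at ht1 ⊢
  have ht0 : 0 < t := by linarith
  have hb : (1 + μ ^ 2 * t)⁻¹ ≤ (μ ^ 2)⁻¹ * t⁻¹ := by
    rw [← mul_inv]
    exact inv_anti₀ (by positivity) (by linarith)
  have h1 : t * (t⁻¹) ^ 3 ≤ t⁻¹ := by
    calc t * (t⁻¹) ^ 3 = (t * t⁻¹) * t⁻¹ * t⁻¹ := by ring
      _ ≤ 1 * 1 * t⁻¹ := by
          rw [mul_inv_cancel₀ ht0.ne']
          exact mul_le_mul_of_nonneg_right (mul_le_mul_of_nonneg_left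
            (inv_le_one_of_one_le₀ ht1) zero_le_one) (inv_nonneg.mpr ht0.le)
      _ = t⁻¹ := by ring
  calc K * 2 ^ 23 * t * ((1 + μ ^ 2 * t)⁻¹) ^ 3 ≤ K * 2 ^ 23 * t * ((μ ^ 2)⁻¹ * t⁻¹) ^ 3 :=
        mul_le_mul_of_nonneg_left (pow_le_pow_left₀ (by positivity) hb 3) (by positivity)
    _ = K * 2 ^ 23 * (μ ^ 2)⁻¹ ^ 3 * (t * (t⁻¹) ^ 3) := by ring
    _ ≤ K * 2 ^ 23 * (μ ^ 2)⁻¹ ^ 3 * t⁻¹ := mul_le_mul_of_nonneg_left h1 (by positivity)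

end Helpers

/-- **Finite-range heat slices, part 1 (sum + mass decay)**: with `Q_U(μ) = D_Wᴴ D_W + μ²` (`D_W` the `r = 1`
Wilson–Dirac matrix of an `SU(3)` field, `m ∈ [−1/2, 1]`, `μ ∈ (0,1]`) and the Bauerschmidt pieces
`C_n = MatrixFRD.piece Q_U(μ) 64 2 n`: `Σ_n C_n = Q_U(μ)⁻¹` (`HasSum`) and `‖C_n v‖₂ ≤ C 4ⁿ (1 + μ² 4ⁿ)⁻³ ‖v‖₂`,
ONE `C` for all `μ, L, U, m, n`. [Bauerschmidt2013 Thm 1.2; BauerschmidtBrydgesSlade2019RG Ch. 3 (3.11)] -/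
theorem stub_frPiecesSumNorm :
    ∃ C : ℝ, ∀ μ : ℝ, μ ∈ Set.Ioc (0 : ℝ) 1 →
      ∀ (L : ℕ) [NeZero L] (U : GaugeConfig 4 L (Matrix.specialUnitaryGroup (Fin 3) ℂ)) (m : ℝ),
        m ∈ Set.Icc (-(1 / 2 : ℝ)) 1 →
        ∀ Q : Matrix (TorusSite 4 L × Fin 3 × Fin 4) (TorusSite 4 L × Fin 3 × Fin 4) ℂ,
          Q = (wilsonDirac (fundamentalRep (Fin 3)) U m 1)ᴴ * wilsonDirac (fundamentalRep (Fin 3)) U m 1 +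
            ((μ : ℂ) ^ 2) • (1 : Matrix (TorusSite 4 L × Fin 3 × Fin 4) (TorusSite 4 L × Fin 3 × Fin 4) ℂ) →
          HasSum (fun n : ℕ => MatrixFRD.piece Q (64 : ℝ) 2 n) Q⁻¹ ∧
          ∀ (n : ℕ) (v : TorusSite 4 L × Fin 3 × Fin 4 → ℂ),
            ∑ i, ‖(MatrixFRD.piece Q (64 : ℝ) 2 n).mulVec v i‖ ^ 2 ≤
              (C * 4 ^ n * ((1 + μ ^ 2 * 4 ^ n)⁻¹) ^ 3) ^ 2 * ∑ i, ‖v i‖ ^ 2 := by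
  obtain ⟨K, hK, hmaj⟩ := Literature.LinearAlgebra.Matrix.MatrixFRD.exists_gFun_le_majorant
  refine ⟨K * 2 ^ 23, fun μ hμ L _ U m hm Q hQ => ?_⟩
  obtain ⟨hQpsd, hsp⟩ :=
    massiveSquare_posSemidef_spectrum (sum_norm_sq_wilsonDirac_mulVec_le_81 U hm) hμ hQ
  have hμ2 : 0 < μ ^ 2 := by have := hμ.1; positivity
  have hsp' : ∀ ν ∈ spectrum ℝ Q, 0 < ν ∧ ν ≤ 2 * 64 := fun ν hν =>
    ⟨lt_of_lt_of_le hμ2 (hsp ν hν).1, by linarith [(hsp ν hν).2]⟩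
  have hs0 : ∀ n : ℕ, 0 ≤ K * 2 ^ 23 * 4 ^ n * ((1 + μ ^ 2 * 4 ^ n)⁻¹) ^ 3 := fun n => by positivity
  have hg : ∀ n : ℕ, ∀ ν ∈ spectrum ℝ Q, |Literature.LinearAlgebra.Matrix.MatrixFRD.gFun 64 2 n ν| ≤
      K * 2 ^ 23 * 4 ^ n * ((1 + μ ^ 2 * 4 ^ n)⁻¹) ^ 3 := by
    intro n ν hν
    rw [abs_of_nonneg
      (Literature.LinearAlgebra.Matrix.MatrixFRD.gFun_nonneg (by norm_num) (by norm_num) n ν)]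
    rcases Nat.eq_zero_or_pos n with rfl | hn
    · rw [gFun_zero_eq]
      exact hs0 0
    · exact gFun_le_decay hK hmaj hμ.1 hμ.2 hn (hsp ν hν).1 (by linarith [(hsp ν hν).2])
  have hl2 : ∀ (n : ℕ) (v : TorusSite 4 L × Fin 3 × Fin 4 → ℂ),
      ∑ i, ‖(MatrixFRD.piece Q (64 : ℝ) 2 n *ᵥ v) i‖ ^ 2 ≤
        (K * 2 ^ 23 * 4 ^ n * ((1 + μ ^ 2 * 4 ^ n)⁻¹) ^ 3) ^ 2 * ∑ i, ‖v i‖ ^ 2 :=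
    fun n v => sum_norm_sq_cfc_mulVec_le Q (hs0 n) (hg n) v
  exact ⟨hasSum_piece_of_summable hQpsd (by norm_num) (by norm_num) hsp'
    (summable_of_sum_norm_sq_mulVec_le hs0 (summable_decay hK.le hμ.1) hl2), fun n v => hl2 n v⟩

end Summit.QuantumFields.QCD.Cruxes.InterleavedFlowProper.FiniteRangeHeatSlices

end
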